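import Literature.MathematicalPhysics.QuantumFieldTheory.Balaban1983to89.Node00.OpsYNablaBridge

/-!
# `Balaban1983to89.B9LocalGaugeZeroModesY` — LOCAL GAUGE ZERO MODES at node00-def-Y's flat kernels: a curl-free fine bond field satisfying
# the homogeneous averaging constraints is the gradient of a gauge potential ([4] Sect. A, r03's `B6SectAZeroModesV1` transported to the
# `Y` carriers), and THAT POTENTIAL VANISHES ON EVERY BLOCK CONTAINING NO BOND OF THE FIELD's SUPPORT (block connectivity + `Q′φ = 0`) —
# the lattice-cohomology input of [B9] p. 416 «In [4] we have proved that the operator G_□(1) is positive» for the LOCAL bond operators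

statement-level skeleton of published theorems with citation tags; proofs where landed; nothing here is a claim about the Yang–Mills mass gap

Sources.  T. Bałaban, *Propagators and renormalization transformations for lattice gauge theories. II*, Commun. Math. Phys. **96** (1984)
223–250 [`Balaban1984PropagatorsII`, "[4]"], Sect. A pp. 224–226: (2.6)–(2.7) (the constraints `Q_jA = 0 on Λ_j`, the gauge space `N(Q′)`),
(2.19)–(2.22) p. 226 («One of our main results will be that the operator Δ_a is bounded from below by a positive constant») — the kernel statement
«∂A = 0, QA = 0 ⇒ A = ∂φ, φ ∈ N(Q′)» is r03's `B6SectAZeroModesV1.exists_inGauge_grad_of_curl_eq_zero` (V1 multi-level torus calculus);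
T. Bałaban, *Propagators for lattice gauge theories in a background field*, Commun. Math. Phys. **99** (1985) 389–434
[`Balaban1985BackgroundPropagators`, "[B9]"], Thm 3.11 proof p. 416 («In [4] we have proved that the operator G_□(1) is positive»), Sect. C
pp. 408–409 (the local operators `G′_□(U), C_□(U), G_□(U)` «for the sequence {Ω_n(□)}»), Cor. 3.5 p. 407 («for U = 1 these theorems are proved in [4]»).

WHY THIS FILE (cell `pub-ymgap`, Track A node N06 = [B9] Thms 3.1–3.15, seat `pub-ymgap-dag-n06-j` = bundle F5 rows 15–17, g22).  Row 17 of the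
N06 certificate (`hΔA`, Thm 3.11 for `Δ_a`) is derivable from row 19's displayed letters plus ONE local clause (this seat's g21
`BalabanUVNodesN06Row17FromRow19Letters.row17_of_row19_letters`), and that clause follows from the Cor. 3.6 positivity `hloc` of the padded local
bond operator `padDeltaALocY` of node00-def-Y's FILE 40 (`BalabanUVNodesN06Row19LocalClauseAtDirichletInverses.hGsqA_of_GAsqY_pins`).  Print's road to
`hloc` (p. 416 + (3.86)) has two inputs: (i) «G_□(1) is positive» ([4]) and (ii) the Sect.-B smallness of `V(A)G_□(1)` in the cube gauge.  THIS FILE is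
the lattice-cohomology half of (i) at def-Y's FLAT KERNELS (`gradK, curlK, qK, qpK` of `Node00.OpsYDeltaA`, real-valued functions on the carriers
`SiteY i ∕ FBondY i`): the companion `B9Thm311LocalBondFlatPosY` lifts it to the `M_N(ℂ)` fibre and concludes `PosDefTr 1 (padDeltaALocY … 1)`.

WHAT IS PROVED (0 `sorry`, 0 `def`, 0 new named facts; axioms standard; every `i : KIdx`).
* §1 TRANSPORT of [4] Sect. A to the flat kernels: `curlK_mulVec` (`curlK·f = ∂f`), `qK_mulVec_eq_zero_iff` (`qK·f = 0` iff the constraints (2.6)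
  with `B = 0`), `gradK_mulVec_chart` (`gradK·(φ∘chart⁻¹) = ∂φ`), `qpK_mulVec_eq_QB`, `inGauge_iff_qpK_mulVec_eq_zero` (`N(Q′)` through the chart,
  p22's `B6ScalarChartV1.inGauge_chart_iff`), ★ `exists_gauge_potential_of_curlK_qK` (`curlK·f = 0 ∧ qK·f = 0 ⇒ ∃ φ, qpK·φ = 0 ∧ gradK·φ = f`).
* §2 BLOCK CONNECTIVITY in p21's box coordinates: `gradK_mulVec_apply` (`(gradK·φ)(b) = c_f(φ(b₊) − φ(b₋))`), `blkOf_eq_of_bounds`, the downward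
  step bond inside a block (`exists_bond_step`), ★ `eq_on_block_of_flat` (a function that does not change across any fine bond with both ends in a
  block `B^j(y)` of `𝔅` is constant on that block — induction on the taxicab offset from the block's corner).
* §3 SUPPORT LOCALISATION: ★★ `potential_eq_zero_on_flat_block` (a gauge potential `φ`, `qpK·φ = 0`, whose gradient vanishes on every bond inside a
  block vanishes identically on that block: constant by §2, and the normalised block average of a constant is the constant), ★★★
  `exists_local_gauge_potential` (`curlK·f = 0`, `qK·f = 0` ⇒ `f = gradK·φ` with `qpK·φ = 0` and `φ = 0` on every block containing no bond of the
  support of `f`) — so a field supported on the bonds of a cube has its gauge potential supported on the blocks meeting those bonds.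
* §4 THE FLAT SITE LAPLACIANS: `divK_gradK_mulVec` (`divK·gradK·g = c_f²·(−Δ^{per})g`, p22's `lapE_chart`) and `mlOpT_mulVec_of_qpK_eq_zero`
  (NODE 00's `Δ′_a = −Δ^{per}` on `N(Q′)`, p22's `mlOpT_mulVec_of_QB_eq_zero`) — the two identities the companion file uses to read `G′_□(1)D*D`.

HONEST SCOPE.  Finite-dimensional lattice algebra at `U = 1` (real fields); the analytic content is r03's zero-mode theorem of [4] Sect. A, transported
verbatim; nothing of [B9]'s estimates (Thms 3.1–3.15, Cor. 3.6 at `U ≠ 1`) is asserted; NOT a node discharge, NOT summit progress; count-neutral; nothing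
continuum, nothing about the mass gap, no claim on the Clay problem.
-/

namespace Literature.MathematicalPhysics.QuantumFieldTheory.Balaban1983to89.B9LocalGaugeZeroModesY

open Literature.MathematicalPhysics.QuantumFieldTheory.Balaban1983to89.Node00
open Literature.MathematicalPhysics.QuantumFieldTheory.Balaban1983to89.B6KLevelCensusIndexV1 (KIdx)
open Literature.MathematicalPhysics.QuantumFieldTheory.Balaban1983to89.B4Reflection242 (boxDom mem_boxDom blk)
open Literature.MathematicalPhysics.QuantumFieldTheory.Balaban1983to89.B6MultiLevelBoxOperator (N0)
open Literature.MathematicalPhysics.QuantumFieldTheory.Balaban1983to89.B6MultiLevelTorusOperator (tshift unitVec perLapT mlOpT tshift_val_of_mem)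
open Literature.MathematicalPhysics.QuantumFieldTheory.Balaban1983to89.B6Geom246MultiLevelBox (bset blkOf blkOf_eq_iff_blk coord_bounds exists_blkOf_eq)
open Literature.MathematicalPhysics.QuantumFieldTheory.Balaban1983to89.B6Ineq268MultiLevelBox (QB QB_apply W W_pos)
open Literature.MathematicalPhysics.QuantumFieldTheory.Balaban1983to89.B6Ineq288MultiLevelTorus (QM)
open Literature.MathematicalPhysics.QuantumFieldTheory.Balaban1983to89.B6GlobalChartV1 (PV boxEquiv toBox domT boxEquiv_apply)
open Literature.MathematicalPhysics.QuantumFieldTheory.Balaban1983to89.B6ScalarChartV1 (toBox_shift toBox_boxEquiv_symm inGauge_chart_iff lapE_chart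
  mlOpT_mulVec_of_QB_eq_zero)
open Literature.MathematicalPhysics.QuantumFieldTheory.Balaban1983to89.B6ScalarAgreeV1Chart (QM_mulVec_apply)
open Literature.MathematicalPhysics.QuantumFieldTheory.Balaban1983to89.B6Ineq2133TwoScaleV1 (onFun onFun_apply)
open Literature.MathematicalPhysics.QuantumFieldTheory.Balaban1983to89.B6SectAOperatorsV1 (dE dsE dcE QE QE_eq_zero_iff lapE dE_apply dcE_apply)
open Literature.MathematicalPhysics.QuantumFieldTheory.Balaban1983to89.B6SectAZeroModesV1 (exists_inGauge_grad_of_curl_eq_zero)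
open Literature.MathematicalPhysics.QuantumFieldTheory.Balaban1983to89.B6Cor28KLevelV1 (onFun_comp)
open OpsYNablaBridge (chartY gradK_apply_tgt gradK_apply_src gradK_apply_of_ne tgt_ne_src)
open LatticeFieldCalculus (grad curl bondAvgIter)
open scoped Matrix

variable {d ℓ : ℕ} {hd : 1 ≤ d + 1} {hL : Odd (ℓ + 1) ∧ 1 < ℓ + 1} {b₀ b₁ : ℝ} (i : KIdx d ℓ hd hL b₀ b₁)

/-! ## §1 Transport of [4] Sect. A's zero-mode theorem to the flat kernels -/

/-- the curl kernel acts as r03's `∂` on bond functions: `curlK·f = ∂f`. [cite: Balaban1985BackgroundPropagators, (3.4) p.391; Balaban1984PropagatorsII, (2.19) p.226, dictionary] -/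
theorem curlK_mulVec (f : FBondY i → ℝ) : curlK i *ᵥ f = curl i.cf f := by
  funext p
  simp only [curlK, LinearMap.toMatrix'_mulVec, onFun_apply, dcE_apply]

/-- `qK·f = 0` iff the homogeneous constraints `Q_jf = 0 on Λ_j` hold for every level `j` ((2.6) with `B = 0`).
[cite: Balaban1984PropagatorsII, (2.6) p.224, (2.20) p.226] -/
theorem qK_mulVec_eq_zero_iff (f : FBondY i → ℝ) :
    qK i *ᵥ f = 0 ↔ ∀ (j : ℕ) (b : PBond (PV d ℓ i.m i.K hd hL) j), (domT i.hN i.D i.hk).LamBond j b → bondAvgIter j f b = 0 := by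
  have h : qK i *ᵥ f = fun x => (QE (domT i.hN i.D i.hk) (WithLp.toLp 2 f)).ofLp x := by
    funext x
    simp only [qK, LinearMap.toMatrix'_mulVec, onFun_apply]
  rw [h, ← QE_eq_zero_iff (domT i.hN i.D i.hk) (WithLp.toLp 2 f), WithLp.ofLp_toLp]
  constructor
  · intro h0
    ext x
    exact congrFun h0 x
  · intro h0
    funext x
    rw [h0]
    rfl

/-- the two ends of a fine bond are different sites of the box. [cite: Balaban1984PropagatorsII, (2.1) p.224, bookkeeping] -/
theorem chartY_tgt_ne_src (b : FBondY i) : chartY i b.tgt ≠ chartY i b.src :=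
  fun h => tgt_ne_src i b ((chartY i).injective h)

/-- `(gradK·φ)(b) = c_f·(φ(b₊) − φ(b₋))`. [cite: Balaban1985BackgroundPropagators, (3.3) p.390, bookkeeping] -/
theorem gradK_mulVec_apply (φ : SiteY i → ℝ) (b : FBondY i) :
    (gradK i *ᵥ φ) b = i.cf * (φ (chartY i b.tgt) - φ (chartY i b.src)) := by
  classical
  rw [Matrix.mulVec, dotProduct, ← Finset.sum_subset (Finset.subset_univ {chartY i b.tgt, chartY i b.src})
    (fun z _ hz => by
      rw [Finset.mem_insert, Finset.mem_singleton, not_or] at hz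
      rw [gradK_apply_of_ne i hz.1 hz.2, zero_mul]),
    Finset.sum_pair (chartY_tgt_ne_src i b), gradK_apply_tgt, gradK_apply_src]
  ring

/-- the gradient kernel on a function read through the chart is r03's `∂`: `gradK·(φ∘chart⁻¹) = ∂φ`.
[cite: Balaban1985BackgroundPropagators, (3.3) p.390; Balaban1984PropagatorsII, (2.19) p.226, dictionary] -/
theorem gradK_mulVec_chart (φ : Site (PV d ℓ i.m i.K hd hL) 0 → ℝ) :
    gradK i *ᵥ (fun z => φ ((chartY i).symm z)) = grad i.cf φ := by
  funext b
  rw [gradK_mulVec_apply]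
  show i.cf * (φ ((chartY i).symm (chartY i b.tgt)) - φ ((chartY i).symm (chartY i b.src))) = i.cf • (φ b.tgt - φ b.src)
  rw [Equiv.symm_apply_apply, Equiv.symm_apply_apply, smul_eq_mul]

/-- `qpK` is the normalised block average `Q′` of p21 (`QB`). [cite: Balaban1984PropagatorsII, (2.14) p.225, dictionary] -/
theorem qpK_mulVec_eq_QB (g : SiteY i → ℝ) : qpK i *ᵥ g = QB i.D.toDomains g := by
  funext y
  rw [QB_apply, Finset.sum_filter, Finset.mul_sum]
  simp only [Matrix.mulVec, dotProduct]
  refine Finset.sum_congr rfl fun x _ => ?_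
  unfold qpK QM
  rw [ite_mul, zero_mul]
  split_ifs <;> simp

/-- the gauge space `N(Q′)` of the V1 domain datum through the chart: `φ∘chart ∈ N(Q′)` iff `qpK·φ = 0`.
[cite: Balaban1984PropagatorsII, (2.7) p.224, (2.10) p.225] -/
theorem inGauge_iff_qpK_mulVec_eq_zero (g : SiteY i → ℝ) :
    (domT i.hN i.D i.hk).InGauge (fun x => g (chartY i x)) ↔ qpK i *ᵥ g = 0 := by
  rw [qpK_mulVec_eq_QB]
  have h : (fun x => g (chartY i x)) = fun x => g (toBox i.hN x) := by
    funext x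
    rw [chartY, boxEquiv_apply]
  rw [h]
  exact inGauge_chart_iff i.hN i.D i.hk g

/-- ★ **[4] Sect. A's ZERO MODES AT THE FLAT KERNELS**: a curl-free fine bond field satisfying the homogeneous constraints is the gradient of a
potential in the gauge space — `curlK·f = 0 ∧ qK·f = 0 ⇒ ∃ φ, qpK·φ = 0 ∧ gradK·φ = f` (r03's `exists_inGauge_grad_of_curl_eq_zero` through the chart).
[cite: Balaban1984PropagatorsII, (2.5)–(2.7) p.224, (2.19)–(2.22) p.226] -/
theorem exists_gauge_potential_of_curlK_qK {f : FBondY i → ℝ} (hcurl : curlK i *ᵥ f = 0) (hq : qK i *ᵥ f = 0) :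
    ∃ φ : SiteY i → ℝ, qpK i *ᵥ φ = 0 ∧ gradK i *ᵥ φ = f := by
  have hc : curl i.cf f = 0 := by rw [← curlK_mulVec]; exact hcurl
  have hA := (qK_mulVec_eq_zero_iff i f).1 hq
  obtain ⟨φ₀, hφ₀, hf⟩ := exists_inGauge_grad_of_curl_eq_zero (domT i.hN i.D i.hk) i.hcf hc hA
  refine ⟨fun z => φ₀ ((chartY i).symm z), ?_, ?_⟩
  · rw [← inGauge_iff_qpK_mulVec_eq_zero]
    simpa only [Equiv.symm_apply_apply] using hφ₀
  · rw [gradK_mulVec_chart, hf]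

/-! ## §2 Block connectivity in the box coordinates -/

/-- a box site whose coordinates lie in the slab of the block `(j, y)` — `L^j y_μ ≤ x_μ < L^j y_μ + L^j` — belongs to that block.
[cite: Balaban1984PropagatorsII, (2.1) p.224, (2.45) p.231, bookkeeping] -/
theorem blkOf_eq_of_bounds {x : SiteY i} {s : BlkY i}
    (h : ∀ μ, (((ℓ + 1) ^ s.1.1 : ℕ) : ℤ) * s.1.2 μ ≤ x.1 μ ∧ x.1 μ < (((ℓ + 1) ^ s.1.1 : ℕ) : ℤ) * s.1.2 μ + (((ℓ + 1) ^ s.1.1 : ℕ) : ℤ)) :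
    blkOf i.D.toDomains x = s := by
  rw [blkOf_eq_iff_blk]
  funext μ
  have hn : (0 : ℤ) < (((ℓ + 1) ^ s.1.1 : ℕ) : ℤ) := by positivity
  show x.1 μ / (((ℓ + 1) ^ s.1.1 : ℕ) : ℤ) = s.1.2 μ
  rw [Int.ediv_eq_iff_of_pos hn]
  constructor
  · rw [mul_comm]; exact (h μ).1
  · rw [mul_comm]; linarith [(h μ).2]

/-- THE DOWNWARD STEP BOND: if `x` and `x − e_μ` are both box sites, the fine bond from `chart⁻¹(x − e_μ)` in direction `μ` ends at `x`.
[cite: Balaban1984PropagatorsII, (2.1) p.224 (periodic lattice), bookkeeping] -/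
theorem exists_bond_step (x : SiteY i) (μ : Fin (d + 1)) (hx : x.1 - unitVec μ ∈ boxDom (N0 ℓ i.Mh i.k i.P')) :
    ∃ b : FBondY i, chartY i b.src = ⟨x.1 - unitVec μ, hx⟩ ∧ chartY i b.tgt = x := by
  refine ⟨⟨(chartY i).symm ⟨x.1 - unitVec μ, hx⟩, μ⟩, Equiv.apply_symm_apply _ _, ?_⟩
  show chartY i (((chartY i).symm ⟨x.1 - unitVec μ, hx⟩).shift μ) = x
  rw [chartY, boxEquiv_apply, toBox_shift, ← boxEquiv_apply, Equiv.apply_symm_apply]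
  apply Subtype.ext
  rw [tshift_val_of_mem (by rw [sub_add_cancel]; exact x.2), sub_add_cancel]

/-- ★ **BLOCK CONNECTIVITY**: a function on the box sites that takes equal values at the two ends of every fine bond with both ends in the block
`(j, y)` of `𝔅` is constant on that block (descending induction to the block's corner `L^j·y`, one unit step at a time).
[cite: Balaban1984PropagatorsII, (2.1) p.224, (2.45) p.231; Balaban1984PropagatorsI, (1.6) p.18] -/
theorem eq_on_block_of_flat {V : Type*} (φ : SiteY i → V) (s : BlkY i)
    (hflat : ∀ b : FBondY i, blkOf i.D.toDomains (chartY i b.src) = s → blkOf i.D.toDomains (chartY i b.tgt) = s →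
      φ (chartY i b.tgt) = φ (chartY i b.src))
    {x x' : SiteY i} (hx : blkOf i.D.toDomains x = s) (hx' : blkOf i.D.toDomains x' = s) : φ x = φ x' := by
  -- the side `n = L^j` and the corner `c = L^j·y`, kept atomic
  obtain ⟨n, hn_def⟩ : ∃ n : ℤ, n = (((ℓ + 1) ^ s.1.1 : ℕ) : ℤ) := ⟨_, rfl⟩
  have hn : 0 < n := by rw [hn_def]; positivity
  obtain ⟨c, hc_def⟩ : ∃ c : Fin (d + 1) → ℤ, c = fun μ => n * s.1.2 μ := ⟨_, rfl⟩
  have hbnd : ∀ z : SiteY i, blkOf i.D.toDomains z = s → ∀ μ, c μ ≤ z.1 μ ∧ z.1 μ < c μ + n := by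
    intro z hz μ
    have h := coord_bounds i.D.toDomains hz μ
    rw [← hn_def] at h
    rw [hc_def]
    exact h
  have hmem_of : ∀ z : SiteY i, (∀ μ, c μ ≤ z.1 μ ∧ z.1 μ < c μ + n) → blkOf i.D.toDomains z = s := by
    intro z h
    refine blkOf_eq_of_bounds i fun μ => ?_
    rw [← hn_def]
    have h' := h μ
    rw [hc_def] at h'
    exact h'
  have hbox : ∀ (z : SiteY i) (μ : Fin (d + 1)), 0 ≤ z.1 μ ∧ z.1 μ < (N0 ℓ i.Mh i.k i.P' μ : ℤ) := fun z μ => (mem_boxDom.1 z.2) μ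
  have hc_nonneg : ∀ μ, 0 ≤ c μ := by
    intro μ
    have hlab : s.1.2 μ = x.1 μ / n := by
      rw [hn_def]
      exact (congrFun ((blkOf_eq_iff_blk _).1 hx) μ).symm
    rw [hc_def]
    exact mul_nonneg hn.le (by rw [hlab]; exact Int.ediv_nonneg (hbox x μ).1 hn.le)
  have hcmem : c ∈ boxDom (N0 ℓ i.Mh i.k i.P') := by
    rw [mem_boxDom]
    intro μ
    exact ⟨hc_nonneg μ, lt_of_le_of_lt (hbnd x hx μ).1 (hbox x μ).2⟩
  -- every site of the block carries the corner value: induction on the total offset from the corner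
  suffices H : ∀ (m : ℕ) (z : SiteY i), blkOf i.D.toDomains z = s → ∑ μ, (z.1 μ - c μ).toNat = m → φ z = φ ⟨c, hcmem⟩ by
    rw [H _ x hx rfl, H _ x' hx' rfl]
  intro m
  induction m using Nat.strong_induction_on with
  | _ m ih =>
    intro z hz hm
    have hb := hbnd z hz
    by_cases h0 : ∀ μ, z.1 μ = c μ
    · have hzc : z = ⟨c, hcmem⟩ := Subtype.ext (funext h0)
      rw [hzc]
    · obtain ⟨μ, hμ⟩ := not_forall.mp h0
      have hμ' : c μ < z.1 μ := lt_of_le_of_ne (hb μ).1 (Ne.symm hμ)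
      -- the coordinates of the site one step down in direction `μ`
      have hval : ∀ ν, (z.1 - unitVec μ) ν = if ν = μ then z.1 ν - 1 else z.1 ν := by
        intro ν
        by_cases hν : ν = μ
        · subst hν
          simp [unitVec]
        · simp [unitVec, hν]
      have hmem : z.1 - unitVec μ ∈ boxDom (N0 ℓ i.Mh i.k i.P') := by
        rw [mem_boxDom]
        intro ν
        rw [hval]
        have hzν := hbox z ν
        have hcμ := hc_nonneg μ
        split_ifs with hν
        · subst hν
          omega
        · exact hzν
      obtain ⟨b, hsrc, htgt⟩ := exists_bond_step i z μ hmem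
      have hz' : blkOf i.D.toDomains (⟨z.1 - unitVec μ, hmem⟩ : SiteY i) = s := by
        refine hmem_of _ fun ν => ?_
        show c ν ≤ (z.1 - unitVec μ) ν ∧ (z.1 - unitVec μ) ν < c ν + n
        rw [hval]
        have hbν := hb ν
        split_ifs with hν
        · subst hν
          omega
        · exact hbν
      have hstep : φ z = φ ⟨z.1 - unitVec μ, hmem⟩ := by
        have h := hflat b (by rw [hsrc]; exact hz') (by rw [htgt]; exact hz)
        rwa [htgt, hsrc] at h
      rw [hstep]
      refine ih _ ?_ _ hz' rfl
      -- the offset drops by one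
      rw [← hm]
      refine Finset.sum_lt_sum (fun ν _ => ?_) ⟨μ, Finset.mem_univ _, ?_⟩
      · show ((z.1 - unitVec μ) ν - c ν).toNat ≤ (z.1 ν - c ν).toNat
        rw [hval]
        split_ifs with hν
        · subst hν
          omega
        · exact le_rfl
      · show ((z.1 - unitVec μ) μ - c μ).toNat < (z.1 μ - c μ).toNat
        rw [hval, if_pos rfl]
        omega

/-! ## §3 Support localisation of the gauge potential -/

/-- ★★ **A GAUGE POTENTIAL VANISHES ON EVERY FLAT BLOCK**: if `qpK·φ = 0` (`φ ∈ N(Q′)`: every normalised block average vanishes) and the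
gradient `gradK·φ` vanishes on every fine bond with both ends in the block `(j, y)`, then `φ = 0` on that block — it is constant there (§2) and the
block average of a constant is the constant. [cite: Balaban1984PropagatorsII, (2.7) p.224, (2.14) p.225, (2.45) p.231] -/
theorem potential_eq_zero_on_flat_block {φ : SiteY i → ℝ} (hq : qpK i *ᵥ φ = 0) (s : BlkY i)
    (hflat : ∀ b : FBondY i, blkOf i.D.toDomains (chartY i b.src) = s → blkOf i.D.toDomains (chartY i b.tgt) = s → (gradK i *ᵥ φ) b = 0)
    {x : SiteY i} (hx : blkOf i.D.toDomains x = s) : φ x = 0 := by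
  classical
  -- constant on the block
  have hconst : ∀ z, blkOf i.D.toDomains z = s → φ z = φ x := fun z hz =>
    eq_on_block_of_flat i φ s (fun b hs ht => by
      have h := hflat b hs ht
      rw [gradK_mulVec_apply, mul_eq_zero] at h
      exact sub_eq_zero.1 (h.resolve_left i.hcf)) hz hx
  -- the block average is `φ x`
  have havg := congrFun hq s
  rw [qpK_mulVec_eq_QB, QB_apply, Pi.zero_apply, mul_eq_zero] at havg
  rcases havg with h | h
  · exact absurd h (inv_ne_zero (W_pos _ _).ne')
  · rw [Finset.sum_congr rfl fun z hz => hconst z (Finset.mem_filter.1 hz).2, Finset.sum_const, nsmul_eq_mul, mul_eq_zero] at h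
    rcases h with h | h
    · exfalso
      obtain ⟨z, hz⟩ := exists_blkOf_eq i.D.toDomains s
      have hpos : 0 < (Finset.univ.filter fun z => blkOf i.D.toDomains z = s).card :=
        Finset.card_pos.2 ⟨z, Finset.mem_filter.2 ⟨Finset.mem_univ _, hz⟩⟩
      exact hpos.ne' (by exact_mod_cast h)
    · exact h

/-- ★★★ **THE LOCAL GAUGE POTENTIAL**: a curl-free fine bond field `f` with `qK·f = 0` is `gradK·φ` for a potential `φ ∈ N(Q′)` that VANISHES ON
EVERY BLOCK OF `𝔅` CONTAINING NO BOND OF THE SUPPORT OF `f` (a bond «in» a block = both ends in it).  For `f` supported on the bonds of a cube `□`,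
`φ` is supported on the blocks meeting `□` — the locality behind the local operators of Sect. C at `U = 1`.
[cite: Balaban1984PropagatorsII, (2.19)–(2.22) p.226, (2.7) p.224; Balaban1985BackgroundPropagators, pp.408–409, Thm 3.11 proof p.416] -/
theorem exists_local_gauge_potential {f : FBondY i → ℝ} (hcurl : curlK i *ᵥ f = 0) (hq : qK i *ᵥ f = 0) :
    ∃ φ : SiteY i → ℝ, qpK i *ᵥ φ = 0 ∧ gradK i *ᵥ φ = f ∧
      ∀ x : SiteY i, (∀ b : FBondY i, blkOf i.D.toDomains (chartY i b.src) = blkOf i.D.toDomains x →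
        blkOf i.D.toDomains (chartY i b.tgt) = blkOf i.D.toDomains x → f b = 0) → φ x = 0 := by
  obtain ⟨φ, hφ, hf⟩ := exists_gauge_potential_of_curlK_qK i hcurl hq
  refine ⟨φ, hφ, hf, fun x hx => ?_⟩
  exact potential_eq_zero_on_flat_block i hφ (blkOf i.D.toDomains x) (fun b hs ht => by rw [hf]; exact hx b hs ht) rfl

/-! ## §4 The flat site Laplacians: `divK·gradK = c_f²·(−Δ^{per})` and `Δ′_a = −Δ^{per}` on `N(Q′)` -/

/-- `divK·(gradK·g) = c_f²·(−Δ^{per})g` — r03's `∂*∂ = lapE c_f` read through the chart (p22's `lapE_chart`).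
[cite: Balaban1984PropagatorsII, (2.8) p.224, (2.13) p.225; Balaban1985BackgroundPropagators, (3.8) p.392] -/
theorem divK_gradK_mulVec (g : SiteY i → ℝ) :
    divK i *ᵥ (gradK i *ᵥ g) = i.cf ^ 2 • (perLapT (N0 ℓ i.Mh i.k i.P') *ᵥ g) := by
  rw [gradK_mulVec, divK_mulVec]
  funext z
  have h := lapE_chart i.hN i.cf g ((boxEquiv i.hN).symm z)
  rw [toBox_boxEquiv_symm] at h
  exact h

/-- NODE 00's site operator `Δ′_a = −Δ^{per} + Σ_j a_j(L^j)^{−2}Q′_j*Q′_j` (p21's `mlOpT`) acts as `−Δ^{per}` on `N(Q′)`: `qpK·g = 0 ⇒ Δ′_a g = −Δ^{per} g`.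
[cite: Balaban1984PropagatorsII, (2.13)–(2.14) p.225 («Of course Q′λ = 0 … Δλ = Δ′_aλ»)] -/
theorem mlOpT_mulVec_of_qpK_eq_zero (a : ℕ → ℝ) {g : SiteY i → ℝ} (hg : qpK i *ᵥ g = 0) :
    mlOpT (N0 ℓ i.Mh i.k i.P') ℓ i.k i.D.lev a *ᵥ g = perLapT (N0 ℓ i.Mh i.k i.P') *ᵥ g :=
  mlOpT_mulVec_of_QB_eq_zero i.D a (by rw [← qpK_mulVec_eq_QB]; exact hg)

end Literature.MathematicalPhysics.QuantumFieldTheory.Balaban1983to89.B9LocalGaugeZeroModesY
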